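import Literature.MathematicalPhysics.QuantumFieldTheory.Balaban1983to89.B9Thm315WholeBlocksRect

/-!
# `Balaban1983to89.B9Thm315WholeSectE3186` — [B9] (3.186) p. 432 AT THE SECT. E LAYER: the located decay `DecayMidY` of the blocks of `Q(U)G̃₂(U)Q*(U)`
# FROM the identity `G̃₂ = G₂ − G₂Q̃*(Q̃G₂Q̃*)⁻¹Q̃G₂` over located (3.186) letters and the four block decays of `QG₂Q*`, `QG₂Q̃*`, `(Q̃G₂Q̃*)⁻¹`, `Q̃G₂Q*`

T. Bałaban, *Propagators for lattice gauge theories in a background field*, Commun. Math. Phys. **99** (1985) 389–434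
[`Balaban1985BackgroundPropagators`, "B9"]; [4] = T. Bałaban, *Propagators and renormalization transformations for lattice gauge theories. II*,
Commun. Math. Phys. **96** (1984) 223–250 [`Balaban1984PropagatorsII`].

statement-level skeleton of published theorems with citation tags; proofs where landed; nothing here is a claim about the Yang–Mills mass gap

THE PRINTED LOCUS (verbatim, p. 432 [PDF 44]).  *"Now the operator G̃₂ can be calculated easily and we get G̃₂ = G₂ − G₂Q̃*(Q̃G₂Q̃*)⁻¹Q̃G₂. (3.186)  This way we can
express C^{(k)}(Λ) in terms of the operators of the type G′, (Q′G′²Q′*)⁻¹, G, (QGQ*)⁻¹. Now let us consider the operators G₂ and (Q̃G₂Q̃*)⁻¹. The operator G₂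
has the same properties as G, … hence we can apply to it the results of Sect. C, especially Theorem 3.7 holds. Similarly Theorem 3.9 can be extended to the
operator (Q̃G₂Q̃*)⁻¹. Expanding these into random walks we get a random walk expansion of C^{(k)}(Λ)."*  p. 429: the wavy operators belong to the extended
sequence `{Ω_j}_{j ≤ k+1}`, `Ω_{k+1} = B^k(Λ)` — their random-walk majorants decay in the distance of ITS block set (the «middle carrier» below).

THE POINT.  Row 24 through the (3.185) slot (`B9Thm315WholeSectERep`, p503636) displays `DecayMidY x 𝔏 𝔢 B₁ U δ` — the decay of the blocks of def-Y's middle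
factor `midSY = Q(U)∘G̃₂(U)∘Q*(U)` along `|y − y′|` (GAPS G-B9-10).  Print obtains it from (3.186) and the Sect. C expansions of `G₂`, `(Q̃G₂Q̃*)⁻¹`.  THIS FILE
types that step at the Sect. E layer, the ES twin of the seat's g0 `B9Thm315Whole` §4 (`Static3186`∕`Local3186`∕`hasRWExpC_of_3186`) now over GENUINE
`Q, Q*` and def-Y's letter `𝔢.Gt2`, with the seat's rectangular block calculus (`B9Thm315WholeBlocksRect`): §1 `op_kernel_3186` — `B9Thm315Decay.kernel_3186`
for OPERATOR-ENTRY rectangular matrices (`‖(S₁ − A·H·B)(p, q)‖ ≤ (c₁ + c_Ac_Hc_BK²)e^{−δ′ρ}`); §2 the located (3.186) LETTERS `Eq3186LettersY 𝔸 x W` at a member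
over a middle carrier `W` (`G2`, `Qt`, `QtT`, `Xinv` = G₂, Q̃, Q̃*, (Q̃G₂Q̃*)⁻¹; the carrier's pseudo-distance `ρW` and the placing `pos` of the index bonds —
PARAMETERS, p. 429's extended sequence is not an object of NODE 00's tree), the pin `GivenBy3186Y 𝔢 𝔤 U : 𝔢.Gt2 U = G₂ − G₂∘Q̃*∘(Q̃G₂Q̃*)⁻¹∘Q̃∘G₂`, the four
sandwiched letters `S1Y`∕`AY`∕`BY` (+ `Xinv`) and ★ `blockMat_midSY_of_givenBy3186Y` (the block identity `blocks(QG̃₂Q*) = blocks(QG₂Q*) − blocks(QG₂Q̃*)·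
blocks((Q̃G₂Q̃*)⁻¹)·blocks(Q̃G₂Q*)`), the schemas `Static3186Y` (profile `Σ_z e^{−(δ−δ′)ρW(w,z)} ≤ K_w`, comparison `|y − y′| ≤ ρW(pos y, pos y′) + a`) and
`Local3186Y` (the four block decays at `U` — the random-walk content, G-B9-10), ★★ `decayMidY_of_3186` (⇒ `DecayMidY x 𝔏 𝔢 (e^{δ′a}(c₁ + c_Ac_Hc_BK_w²)) U δ′`);
§3 ★★ `thm315FullPrinted_sectE_of_3186` (row 24 at `operatorLayerYSectE` from the (3.185) identity, `LocalOuterY`, (3.186) + `Local3186Y` on the prefix and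
`Static3186Y` per member) and the record faces `t315_opsYSectE_of_3186`, `t315_opsYOfRecordV4E_of_3186`.

HONEST SCOPE.  Count-neutral kernel bookkeeping; the four block decays (Thm 3.7 for `G₂`, Thm 3.9 for `(Q̃G₂Q̃*)⁻¹`, p. 432 — by analogy in print; GAPS G-B9-10:
the `G₂ − G₁` perturbation (3.183)–(3.184) is not estimated in print), the (3.186) identity for def-Y's letter, the middle carrier's profile and the (3.185)
identity stay DISPLAYED hypotheses.  Nothing of print asserted; NOT a node discharge (N06 unmoved), NOT summit progress; one finite lattice programme at fixed ε;
nothing continuum ∕ ℝ⁴ ∕ OS ∕ mass gap ∕ Clay.  Cell `pub-ymgap` (D-0062), node N06 [B9], bundle F8 row 24 (successor file), seat `pub-ymgap-dag-n06-m` (g4),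
2026-08-27.  Imports the seat's `B9Thm315WholeBlocksRect`; nothing restated.  Net new unproved facts: 0.
-/

noncomputable section

namespace Literature.MathematicalPhysics.QuantumFieldTheory.Balaban1983to89.B9Thm315WholeSectE3186

open B9 Node00
open B4Sect5Torus (IsPseudoDist)
open B6KLevelCensusIndexV1 (KIdx)
open B9PinMembersKLevelV1 (MemberY geo9Y bg9Y)
open B9PinCarriersKLevelV1 (OperatorLayerY)
open B9PinGeometryKLevelV1 (inΛY unitDistY c35Y)
open B7Prop2SpecialUnitary (specialUnitaryUnits)
open B9Eq3187Op (nrm nrm_apply)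
open B9Thm315WholeBlocks (blockCLM blockMat blockMat_apply blockCLM_apply)
open B9Thm315WholeBlocksRect (blockCLM₂ blockMat₂ blockMat₂_apply blockCLM₂_apply blockMat₂_comp blockMat₂_eq_blockMat blockCLM₂_eq_blockCLM)
open B9Thm315WholeSectERep (outerLY midSY outerRY LocalOuterY DecayMidY bound3187_sectE_of_3185)
open scoped Matrix

/-! ## §1 (3.186) for operator-entry rectangular matrices: `‖(S₁ − A·H·B)(p, q)‖` through a middle carrier with a lattice-sum profile -/

section Sandwich

variable {𝔸' : Type} [NormedRing 𝔸'] {P W : Type} [Fintype P] [Fintype W]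

omit [Fintype P] in
/-- the norm reduction `‖(S₁ − A·H·B)(p, q)‖ ≤ ‖S₁(p, q)‖ + Σ_{z′}(Σ_z ‖A(p, z)‖‖H(z, z′)‖)‖B(z′, q)‖`. [cite: Balaban1985BackgroundPropagators, (3.186) p.432, bookkeeping] -/
theorem norm_sub_mul₃_apply_le (S₁ : Matrix P P 𝔸') (A : Matrix P W 𝔸') (H : Matrix W W 𝔸') (B : Matrix W P 𝔸') (p q : P) :
    ‖(S₁ - A * H * B) p q‖ ≤ ‖S₁ p q‖ + ∑ z', (∑ z, ‖A p z‖ * ‖H z z'‖) * ‖B z' q‖ := by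
  rw [Matrix.sub_apply]
  refine (norm_sub_le _ _).trans (add_le_add le_rfl ?_)
  simp only [Matrix.mul_apply]
  refine (norm_sum_le _ _).trans (Finset.sum_le_sum fun z' _ => ?_)
  refine (norm_mul_le _ _).trans ?_
  exact mul_le_mul_of_nonneg_right ((norm_sum_le _ _).trans (Finset.sum_le_sum fun z _ => norm_mul_le _ _)) (norm_nonneg _)

omit [Fintype P] in
/-- ★ **(3.186) SANDWICHED, OPERATOR ENTRIES** (`B9Thm315Decay.kernel_3186` on the norm majorants): if `‖S₁(p,q)‖ ≤ c₁e^{−δρ(pos p, pos q)}`, `‖A(p,z)‖ ≤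
c_Ae^{−δρ(pos p, z)}`, `‖H(z,z′)‖ ≤ c_He^{−δρ(z,z′)}`, `‖B(z,q)‖ ≤ c_Be^{−δρ(z, pos q)}` and the middle carrier has the profile `Σ_z e^{−(δ−δ′)ρ(w,z)} ≤ K`
(`0 ≤ δ′ ≤ δ`), then `‖(S₁ − A·H·B)(p, q)‖ ≤ (c₁ + c_Ac_Hc_BK²)·e^{−δ′ρ(pos p, pos q)}`.
[cite: Balaban1985BackgroundPropagators, (3.186) p.432; Balaban1984PropagatorsII, (2.52)∕(2.55) pp.232–233 + (2.61) p.234] -/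
theorem op_kernel_3186 (ρ : W → W → ℝ) (hρ : IsPseudoDist ρ) (pos : P → W) (S₁ : Matrix P P 𝔸') (A : Matrix P W 𝔸') (H : Matrix W W 𝔸')
    (B : Matrix W P 𝔸') {c₁ cA cH cB δ δ' K : ℝ} (hc₁ : 0 ≤ c₁) (hcA : 0 ≤ cA) (hcH : 0 ≤ cH) (hcB : 0 ≤ cB) (hδ' : 0 ≤ δ') (hδ'δ : δ' ≤ δ)
    (hK : ∀ w : W, ∑ z : W, Real.exp (-((δ - δ') * ρ w z)) ≤ K)
    (hS₁ : ∀ p q, ‖S₁ p q‖ ≤ c₁ * Real.exp (-(δ * ρ (pos p) (pos q))))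
    (hA : ∀ p z, ‖A p z‖ ≤ cA * Real.exp (-(δ * ρ (pos p) z)))
    (hH : ∀ z z', ‖H z z'‖ ≤ cH * Real.exp (-(δ * ρ z z')))
    (hB : ∀ z q, ‖B z q‖ ≤ cB * Real.exp (-(δ * ρ z (pos q)))) (p q : P) :
    ‖(S₁ - A * H * B) p q‖ ≤ (c₁ + cA * cH * cB * K * K) * Real.exp (-(δ' * ρ (pos p) (pos q))) := by
  have hker := B9Thm315Decay.kernel_3186 ρ hρ pos (nrm S₁) (-Matrix.of fun p z => ‖A p z‖) (Matrix.of fun z z' => ‖H z z'‖)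
    (Matrix.of fun z q => ‖B z q‖) hc₁ hcA hcH hcB hδ' hδ'δ hK
    (fun p q => by rw [nrm_apply, abs_norm]; exact hS₁ p q)
    (fun p z => by rw [Matrix.neg_apply, Matrix.of_apply, abs_neg, abs_norm]; exact hA p z)
    (fun z z' => by rw [Matrix.of_apply, abs_norm]; exact hH z z')
    (fun z q => by rw [Matrix.of_apply, abs_norm]; exact hB z q) p q
  have hx : (nrm S₁ - (-Matrix.of fun p z => ‖A p z‖) * (Matrix.of fun z z' => ‖H z z'‖) * (Matrix.of fun z q => ‖B z q‖)) p q =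
      ‖S₁ p q‖ + ∑ z', (∑ z, ‖A p z‖ * ‖H z z'‖) * ‖B z' q‖ := by
    simp only [Matrix.sub_apply, Matrix.mul_apply, Matrix.neg_apply, Matrix.of_apply, nrm_apply, neg_mul, Finset.sum_neg_distrib, sub_neg_eq_add]
  rw [hx] at hker
  exact ((norm_sub_mul₃_apply_le S₁ A H B p q).trans (le_abs_self _)).trans hker

end Sandwich

/-! ## §2 The (3.186) letters at a member, the pin on def-Y's `G̃₂`, the block identity, and `DecayMidY` from the four block decays -/

section Letters

variable {d ℓ : ℕ} {hd : 1 ≤ d + 1} {hL : Odd (ℓ + 1) ∧ 1 < ℓ + 1} {b₀ b₁ : ℝ} {Mstar : ℕ}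
variable (𝔸 : Type) [NormedRing 𝔸] [NormedAlgebra ℂ 𝔸] [CompleteSpace 𝔸]

/-- ★ **THE LOCATED LETTERS OF (3.186) AT A MEMBER** over a middle carrier `W` (the block set of the extended sequence `{Ω_j}_{j≤k+1}`, `Ω_{k+1} = B^k(Λ)`, p. 429 —
NOT an object of NODE 00's tree; PARAMETERS): `G2 U` = `G₂(U)` on fine-bond functions («the same properties as G», p. 432), `Qt U` = `Q̃(U)` (fine bonds →
W), `QtT U` = `Q̃*(U)`, `Xinv U` = `(Q̃G₂Q̃*)⁻¹(U)` on W-functions; `ρW` = the carrier's distance, `pos` = the placing of the index bonds of Λ in W.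
[cite: Balaban1985BackgroundPropagators, (3.186) p.432, p.429 (the extended sequence)] -/
structure Eq3186LettersY (x : MemberY d ℓ hd hL b₀ b₁ Mstar) (W : Type) where
  G2 : BondOpY 𝔸 x.toKIdx
  Qt : CfgY 𝔸 x.toKIdx → (FBondY x.toKIdx → 𝔸) →ₗ[ℂ] (W → 𝔸)
  QtT : CfgY 𝔸 x.toKIdx → (W → 𝔸) →ₗ[ℂ] (FBondY x.toKIdx → 𝔸)
  Xinv : CfgY 𝔸 x.toKIdx → (W → 𝔸) →ₗ[ℂ] (W → 𝔸)
  ρW : W → W → ℝ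
  pos : IBondY x.toKIdx → W

variable {𝔸} {x : MemberY d ℓ hd hL b₀ b₁ Mstar} {W : Type}

/-- ★ **THE PIN (3.186) ON def-Y's LETTER `G̃₂`**: `𝔢.Gt2 U = G₂ − G₂∘Q̃*∘(Q̃G₂Q̃*)⁻¹∘Q̃∘G₂` at `U`.  A hypothesis schema (an identity between def-Y's residual
letter and the located letters; `rfl` once def-Y defines `Gt2` by (3.186)). [cite: Balaban1985BackgroundPropagators, (3.186) p.432] -/
def GivenBy3186Y (𝔢 : SectELettersY 𝔸 x) (𝔤 : Eq3186LettersY 𝔸 x W) (U : CfgY 𝔸 x.toKIdx) : Prop :=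
  𝔢.Gt2 U = 𝔤.G2 U - 𝔤.G2 U ∘ₗ 𝔤.QtT U ∘ₗ 𝔤.Xinv U ∘ₗ 𝔤.Qt U ∘ₗ 𝔤.G2 U

variable (x) in
/-- `S₁ = Q(U)G₂(U)Q*(U)` on the index-bond functions. [cite: Balaban1985BackgroundPropagators, (3.185)–(3.186) p.432] -/
def S1Y (𝔏 : CovLettersY 𝔸 x) (𝔤 : Eq3186LettersY 𝔸 x W) : IBondOpY 𝔸 x.toKIdx :=
  fun U => QY x.toKIdx 𝔏.parB U ∘ₗ 𝔤.G2 U ∘ₗ QsY x.toKIdx 𝔏.parB U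

variable (x) in
/-- `A = Q(U)G₂(U)Q̃*(U)` (W-functions → index-bond functions). [cite: Balaban1985BackgroundPropagators, (3.186) p.432] -/
def AY (𝔏 : CovLettersY 𝔸 x) (𝔤 : Eq3186LettersY 𝔸 x W) : CfgY 𝔸 x.toKIdx → (W → 𝔸) →ₗ[ℂ] (IBondY x.toKIdx → 𝔸) :=
  fun U => QY x.toKIdx 𝔏.parB U ∘ₗ 𝔤.G2 U ∘ₗ 𝔤.QtT U

variable (x) in
/-- `B = Q̃(U)G₂(U)Q*(U)` (index-bond functions → W-functions). [cite: Balaban1985BackgroundPropagators, (3.186) p.432] -/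
def BY (𝔏 : CovLettersY 𝔸 x) (𝔤 : Eq3186LettersY 𝔸 x W) : CfgY 𝔸 x.toKIdx → (IBondY x.toKIdx → 𝔸) →ₗ[ℂ] (W → 𝔸) :=
  fun U => 𝔤.Qt U ∘ₗ 𝔤.G2 U ∘ₗ QsY x.toKIdx 𝔏.parB U

/-- **(3.186) SANDWICHED BY `Q ⋯ Q*` AS AN OPERATOR IDENTITY**: `QG̃₂Q* = QG₂Q* − (QG₂Q̃*)∘(Q̃G₂Q̃*)⁻¹∘(Q̃G₂Q*)`.
[cite: Balaban1985BackgroundPropagators, (3.185)–(3.186) p.432, bookkeeping] -/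
theorem midSY_eq_of_givenBy3186Y {𝔏 : CovLettersY 𝔸 x} {𝔢 : SectELettersY 𝔸 x} {𝔤 : Eq3186LettersY 𝔸 x W} {U : CfgY 𝔸 x.toKIdx}
    (h : GivenBy3186Y 𝔢 𝔤 U) : midSY x 𝔏 𝔢 U = S1Y x 𝔏 𝔤 U - AY x 𝔏 𝔤 U ∘ₗ 𝔤.Xinv U ∘ₗ BY x 𝔏 𝔤 U := by
  show QY x.toKIdx 𝔏.parB U ∘ₗ 𝔢.Gt2 U ∘ₗ QsY x.toKIdx 𝔏.parB U = _
  rw [h]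
  simp only [S1Y, AY, BY, LinearMap.comp_sub, LinearMap.sub_comp, LinearMap.comp_assoc]

variable [FiniteDimensional ℂ 𝔸] [Fintype W]

omit [CompleteSpace 𝔸] in
/-- blocks of a difference. [cite: Balaban1985BackgroundPropagators, (3.186) p.432, bookkeeping] -/
theorem blockMat₂_sub {X Y : Type} (T S : (Y → 𝔸) →ₗ[ℂ] (X → 𝔸)) : blockMat₂ (T - S) = blockMat₂ T - blockMat₂ S := by
  ext z w a; rfl

/-- ★ **THE BLOCK IDENTITY OF (3.186), SANDWICHED**: `blocks(QG̃₂Q*) = blocks(QG₂Q*) − blocks(QG₂Q̃*)·blocks((Q̃G₂Q̃*)⁻¹)·blocks(Q̃G₂Q*)` (rectangular block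
matrices through the middle carrier). [cite: Balaban1985BackgroundPropagators, (3.186) p.432, bookkeeping] -/
theorem blockMat_midSY_of_givenBy3186Y {𝔏 : CovLettersY 𝔸 x} {𝔢 : SectELettersY 𝔸 x} {𝔤 : Eq3186LettersY 𝔸 x W} {U : CfgY 𝔸 x.toKIdx}
    (h : GivenBy3186Y 𝔢 𝔤 U) :
    blockMat (midSY x 𝔏 𝔢 U) = blockMat₂ (S1Y x 𝔏 𝔤 U) - blockMat₂ (AY x 𝔏 𝔤 U) * blockMat₂ (𝔤.Xinv U) * blockMat₂ (BY x 𝔏 𝔤 U) := by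
  rw [← blockMat₂_eq_blockMat, midSY_eq_of_givenBy3186Y h, blockMat₂_sub, blockMat₂_comp, blockMat₂_comp, ← Matrix.mul_assoc]

variable (x) in
/-- **THE STATIC DATA OF THE MIDDLE CARRIER**: `ρW` is a pseudo-distance with the lattice-sum profile `Σ_z e^{−(δ−δ′)ρW(w,z)} ≤ K_w` ([4] Lemma 2.1 shape) and
DOMINATES `|y − y′|` on the index bonds through the placing up to the additive constant `a`.  A hypothesis schema (the extended sequence's geometry).
[cite: Balaban1985BackgroundPropagators, (3.186) p.432 + p.429; Balaban1984PropagatorsII, Lemma 2.1 (2.61) p.234] -/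
structure Static3186Y (𝔤 : Eq3186LettersY 𝔸 x W) (δ δ' Kw a : ℝ) : Prop where
  pdistW : IsPseudoDist 𝔤.ρW
  profile : ∀ w : W, ∑ z : W, Real.exp (-((δ - δ') * 𝔤.ρW w z)) ≤ Kw
  cmp : ∀ p q : IBondY x.toKIdx, unitDistY x p q ≤ 𝔤.ρW (𝔤.pos p) (𝔤.pos q) + a

variable (x) in
/-- ★ **THE FOUR BLOCK DECAYS OF (3.186) AT `U`** (the random-walk content, p. 432: Thm 3.7 for `G₂`, Thm 3.9 for `(Q̃G₂Q̃*)⁻¹`; GAPS G-B9-10): the blocks of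
`QG₂Q*`, `QG₂Q̃*`, `(Q̃G₂Q̃*)⁻¹`, `Q̃G₂Q*` are bounded by `c₁, c_A, c_H, c_B` times `e^{−δ·ρW}` (index bonds placed by `pos`).  A hypothesis schema.
[cite: Balaban1985BackgroundPropagators, (3.186) p.432, Thm 3.7 (3.90) p.409, Thm 3.9 (3.98) p.413] -/
structure Local3186Y (𝔏 : CovLettersY 𝔸 x) (𝔤 : Eq3186LettersY 𝔸 x W) (U : CfgY 𝔸 x.toKIdx) (δ c₁ cA cH cB : ℝ) : Prop where
  hS₁ : ∀ p q : IBondY x.toKIdx, ‖blockCLM₂ (S1Y x 𝔏 𝔤 U) p q‖ ≤ c₁ * Real.exp (-(δ * 𝔤.ρW (𝔤.pos p) (𝔤.pos q)))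
  hA : ∀ (p : IBondY x.toKIdx) (z : W), ‖blockCLM₂ (AY x 𝔏 𝔤 U) p z‖ ≤ cA * Real.exp (-(δ * 𝔤.ρW (𝔤.pos p) z))
  hH : ∀ z z' : W, ‖blockCLM₂ (𝔤.Xinv U) z z'‖ ≤ cH * Real.exp (-(δ * 𝔤.ρW z z'))
  hB : ∀ (z : W) (q : IBondY x.toKIdx), ‖blockCLM₂ (BY x 𝔏 𝔤 U) z q‖ ≤ cB * Real.exp (-(δ * 𝔤.ρW z (𝔤.pos q)))

/-- ★★ **(3.186) ⇒ `DecayMidY`**: under `Static3186Y` (rate gap `δ − δ′`, profile `K_w`, comparison constant `a`), the pin (3.186) on `G̃₂` and the four block decays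
at `U`, the blocks of `Q(U)G̃₂(U)Q*(U)` decay like `e^{δ′a}(c₁ + c_Ac_Hc_BK_w²)·e^{−δ′|y−y′|}` — the `DecayMidY` hypothesis of `B9Thm315WholeSectERep` at `(U, δ′)`.
[cite: Balaban1985BackgroundPropagators, (3.186) p.432; Balaban1984PropagatorsII, (2.52)∕(2.55) pp.232–233] -/
theorem decayMidY_of_3186 {𝔏 : CovLettersY 𝔸 x} {𝔢 : SectELettersY 𝔸 x} {𝔤 : Eq3186LettersY 𝔸 x W} {U : CfgY 𝔸 x.toKIdx}
    {δ δ' Kw a c₁ cA cH cB : ℝ} (hc₁ : 0 ≤ c₁) (hcA : 0 ≤ cA) (hcH : 0 ≤ cH) (hcB : 0 ≤ cB) (hδ' : 0 ≤ δ') (hδ'δ : δ' ≤ δ)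
    (hst : Static3186Y x 𝔤 δ δ' Kw a) (h86 : GivenBy3186Y 𝔢 𝔤 U) (hl : Local3186Y x 𝔏 𝔤 U δ c₁ cA cH cB) :
    DecayMidY x 𝔏 𝔢 (Real.exp (δ' * a) * (c₁ + cA * cH * cB * Kw * Kw)) U δ' := by
  intro p q
  have hker := op_kernel_3186 𝔤.ρW hst.pdistW 𝔤.pos (blockMat₂ (S1Y x 𝔏 𝔤 U)) (blockMat₂ (AY x 𝔏 𝔤 U)) (blockMat₂ (𝔤.Xinv U))
    (blockMat₂ (BY x 𝔏 𝔤 U)) hc₁ hcA hcH hcB hδ' hδ'δ hst.profile hl.hS₁ hl.hA hl.hH hl.hB p q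
  rw [← blockMat_midSY_of_givenBy3186Y h86, blockMat_apply] at hker
  have hc : 0 ≤ c₁ + cA * cH * cB * Kw * Kw := by
    have : 0 ≤ cA * cH * cB * Kw * Kw := by
      rw [mul_assoc (cA * cH * cB)]
      exact mul_nonneg (mul_nonneg (mul_nonneg hcA hcH) hcB) (mul_self_nonneg Kw)
    linarith
  have h2 : Real.exp (-(δ' * 𝔤.ρW (𝔤.pos p) (𝔤.pos q))) ≤ Real.exp (δ' * a) * Real.exp (-(δ' * unitDistY x p q)) := by
    rw [← Real.exp_add]
    refine Real.exp_le_exp.mpr ?_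
    have := mul_le_mul_of_nonneg_left (hst.cmp p q) hδ'
    rw [mul_add] at this
    linarith
  calc ‖blockCLM (midSY x 𝔏 𝔢 U) p q‖ ≤ (c₁ + cA * cH * cB * Kw * Kw) * Real.exp (-(δ' * 𝔤.ρW (𝔤.pos p) (𝔤.pos q))) := hker
    _ ≤ (c₁ + cA * cH * cB * Kw * Kw) * (Real.exp (δ' * a) * Real.exp (-(δ' * unitDistY x p q))) := mul_le_mul_of_nonneg_left h2 hc
    _ = Real.exp (δ' * a) * (c₁ + cA * cH * cB * Kw * Kw) * Real.exp (-(δ' * unitDistY x p q)) := by ring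

end Letters

/-! ## §3 ROW 24 through the (3.185) slot with `DecayMidY` SUPPLIED from (3.186) -/

section Layer

variable {d ℓ : ℕ} {hd : 1 ≤ d + 1} {hL : Odd (ℓ + 1) ∧ 1 < ℓ + 1} {b₀ b₁ : ℝ} {Mstar : ℕ}
variable {𝔸 : Type} [NormedRing 𝔸] [NormedAlgebra ℂ 𝔸] [CompleteSpace 𝔸] [FiniteDimensional ℂ 𝔸] {G : Subgroup 𝔸ˣ}
variable {W : MemberY d ℓ hd hL b₀ b₁ Mstar → Type} [∀ x, Fintype (W x)]

/-- ★★ **THEOREM 3.15 AS THE WHOLE PRINTED LEAF AT THE SECT. E LAYER FROM (3.185) AND THE LETTERS OF (3.186)** (p. 432: *"This way we can express C^{(k)}(Λ) in terms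
of the operators of the type G′, (Q′G′²Q′*)⁻¹, G, (QGQ*)⁻¹. Expanding these into random walks … The formula (3.185) implies immediately bounds and an exponential
decay. Thus we get Theorem 3.15."*): per member the middle carrier's static data `Static3186Y` (uniform constants); under the printed prefix the (3.185) identity,
the expansion clause at rate `δ′`, the outer locality `LocalOuterY … U`, the (3.186) identity and its four block decays `Local3186Y` (`c₁ > 0`); OUTPUT `δ₀ = δ′`,
`B₀ = e^{δ′a}(c₁ + c_Ac_Hc_BK_w²)·e^{2δ′r}·m_E·m_F`.  Nothing of print asserted (GAPS G-B9-09∕10∕17 travel with the hypotheses); NOT a node discharge.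
[cite: Balaban1985BackgroundPropagators, Thm 3.15 (3.185)–(3.187) p.432, (3.186) p.432, (3.169) p.430] -/
theorem thm315FullPrinted_sectE_of_3186
    (ops : ∀ x : MemberY d ℓ hd hL b₀ b₁ Mstar, OperatorLayerY d ℓ hd hL b₀ b₁ Mstar 𝔸 G x)
    (𝔏 : ∀ x : MemberY d ℓ hd hL b₀ b₁ Mstar, CovLettersY 𝔸 x) (𝔢 : ∀ x : MemberY d ℓ hd hL b₀ b₁ Mstar, SectELettersY 𝔸 x)
    (𝔴 : ∀ x : MemberY d ℓ hd hL b₀ b₁ Mstar, RWLettersEY 𝔸 G x) (𝔤 : ∀ x : MemberY d ℓ hd hL b₀ b₁ Mstar, Eq3186LettersY 𝔸 x (W x))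
    {a₀ δ δ' Kw a c₁ cA cH cB r mE mF : ℝ} (ha₀ : 0 < a₀) (hδ' : 0 < δ') (hδ'δ : δ' ≤ δ) (hc₁ : 0 < c₁) (hcA : 0 ≤ cA) (hcH : 0 ≤ cH) (hcB : 0 ≤ cB)
    (hmE : 0 < mE) (hmF : 0 < mF) (hst : ∀ x, Static3186Y x (𝔤 x) δ δ' Kw a)
    (h : ∀ (x : MemberY d ℓ hd hL b₀ b₁ Mstar) (α₀ : ℝ), 0 < α₀ → (geo9Y x).M * α₀ ≤ a₀ →
      ∀ U : (bg9Y 𝔸 G x).Cfg, (bg9Y 𝔸 G x).Reg335 c35Y α₀ U → (bg9Y 𝔸 G x).Reg336 c35Y α₀ U →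
        givenBy3185Y x (𝔏 x) (𝔢 x) U ∧ hasRWExpCY (𝔴 x) U δ' ∧ LocalOuterY x (𝔢 x) r mE mF U ∧
          GivenBy3186Y (𝔢 x) (𝔤 x) U ∧ Local3186Y x (𝔏 x) (𝔤 x) U δ c₁ cA cH cB) :
    B9.Thm315FullPrinted c35Y geo9Y (bg9Y 𝔸 G)
      (fun x => (operatorLayerYSectE 𝔸 G x (ops x) (𝔏 x) (𝔢 x) (𝔴 x)).Ck) inΛY unitDistY
      (fun x => (operatorLayerYSectE 𝔸 G x (ops x) (𝔏 x) (𝔢 x) (𝔴 x)).GivenBy3185)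
      (fun x => (operatorLayerYSectE 𝔸 G x (ops x) (𝔏 x) (𝔢 x) (𝔴 x)).HasRWExpC) := by
  have hB₁ : 0 < Real.exp (δ' * a) * (c₁ + cA * cH * cB * Kw * Kw) := by
    refine mul_pos (Real.exp_pos _) ?_
    have : 0 ≤ cA * cH * cB * Kw * Kw := by
      rw [mul_assoc (cA * cH * cB)]
      exact mul_nonneg (mul_nonneg (mul_nonneg hcA hcH) hcB) (mul_self_nonneg Kw)
    linarith
  refine ⟨δ', a₀, Real.exp (δ' * a) * (c₁ + cA * cH * cB * Kw * Kw) * Real.exp (2 * δ' * r) * mE * mF, hδ', ha₀, by positivity,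
    fun x α₀ hα hMa U hU hU' => ?_⟩
  obtain ⟨h85, hRW, hLoc, h86, hl⟩ := h x α₀ hα hMa U hU hU'
  exact ⟨h85, hRW, fun y y' _ _ => bound3187_sectE_of_3185 hB₁.le hδ'.le h85 hLoc
    (decayMidY_of_3186 hc₁.le hcA hcH hcB hδ'.le hδ'δ (hst x) h86 hl) y y'⟩

end Layer

/-! ## §4 Record level: ROW 24 from (3.185) + (3.186) at `opsYSectE` and at the v4 record `opsYOfRecordV4E` -/

section Record

open scoped Matrix.Norms.L2Operator

variable (N : ℕ) (θ : Stage3Params) (Mstar : ℕ) {W : MemberY θ.d₆ θ.ℓ₆ θ.hd' θ.hL' θ.b₀ θ.b₁ Mstar → Type} [∀ x, Fintype (W x)]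

/-- ★★ **ROW 24 (`t315`) AT THE SECT. E LAYER FAMILY `opsYSectE N θ M⋆ ops 𝔏 𝔢 𝔴` FROM (3.185) AND THE LETTERS OF (3.186)** (generic base family and letters).
[cite: Balaban1985BackgroundPropagators, Thm 3.15 (3.185)–(3.187) p.432, (3.186) p.432] -/
theorem t315_opsYSectE_of_3186 (ops : OpsY N θ Mstar) (𝔏 : LettersY N θ Mstar) (𝔢 : SectEY N θ Mstar) (𝔴 : RWEY N θ Mstar)
    (𝔤 : ∀ x : MemberY θ.d₆ θ.ℓ₆ θ.hd' θ.hL' θ.b₀ θ.b₁ Mstar, Eq3186LettersY (Matrix (Fin N) (Fin N) ℂ) x (W x))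
    {a₀ δ δ' Kw a c₁ cA cH cB r mE mF : ℝ} (ha₀ : 0 < a₀) (hδ' : 0 < δ') (hδ'δ : δ' ≤ δ) (hc₁ : 0 < c₁) (hcA : 0 ≤ cA) (hcH : 0 ≤ cH) (hcB : 0 ≤ cB)
    (hmE : 0 < mE) (hmF : 0 < mF) (hst : ∀ x, Static3186Y x (𝔤 x) δ δ' Kw a)
    (h : ∀ (x : MemberY θ.d₆ θ.ℓ₆ θ.hd' θ.hL' θ.b₀ θ.b₁ Mstar) (α₀ : ℝ), 0 < α₀ → (geo9Y x).M * α₀ ≤ a₀ →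
      ∀ U : (bg9Y (Matrix (Fin N) (Fin N) ℂ) (specialUnitaryUnits (Fin N)) x).Cfg,
        (bg9Y (Matrix (Fin N) (Fin N) ℂ) (specialUnitaryUnits (Fin N)) x).Reg335 c35Y α₀ U →
        (bg9Y (Matrix (Fin N) (Fin N) ℂ) (specialUnitaryUnits (Fin N)) x).Reg336 c35Y α₀ U →
          givenBy3185Y x (𝔏 x) (𝔢 x) U ∧ hasRWExpCY (𝔴 x) U δ' ∧ LocalOuterY x (𝔢 x) r mE mF U ∧
            GivenBy3186Y (𝔢 x) (𝔤 x) U ∧ Local3186Y x (𝔏 x) (𝔤 x) U δ c₁ cA cH cB) :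
    B9.Thm315FullPrinted c35Y geo9Y (bg9Y (Matrix (Fin N) (Fin N) ℂ) (specialUnitaryUnits (Fin N)))
      (fun x => (opsYSectE N θ Mstar ops 𝔏 𝔢 𝔴 x).Ck) inΛY unitDistY
      (fun x => (opsYSectE N θ Mstar ops 𝔏 𝔢 𝔴 x).GivenBy3185) (fun x => (opsYSectE N θ Mstar ops 𝔏 𝔢 𝔴 x).HasRWExpC) :=
  thm315FullPrinted_sectE_of_3186 ops 𝔏 𝔢 𝔴 𝔤 ha₀ hδ' hδ'δ hc₁ hcA hcH hcB hmE hmF hst h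

/-- ★★ **ROW 24 (`t315`) AT def-Y's v4 INSTANCE OF RECORD `opsYOfRecordV4E N θ M⋆ 𝔯 𝔢 𝔴 𝔈` FROM (3.185) AND THE LETTERS OF (3.186)** (the binder VERBATIM).
[cite: Balaban1985BackgroundPropagators, Thm 3.15 (3.185)–(3.187) p.432, (3.186) p.432] -/
theorem t315_opsYOfRecordV4E_of_3186 (𝔯 : ResY N θ Mstar) (𝔢 : SectEY N θ Mstar) (𝔴 : RWEY N θ Mstar) (𝔈 : ExpsY N θ Mstar)
    (𝔤 : ∀ x : MemberY θ.d₆ θ.ℓ₆ θ.hd' θ.hL' θ.b₀ θ.b₁ Mstar, Eq3186LettersY (Matrix (Fin N) (Fin N) ℂ) x (W x))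
    {a₀ δ δ' Kw a c₁ cA cH cB r mE mF : ℝ} (ha₀ : 0 < a₀) (hδ' : 0 < δ') (hδ'δ : δ' ≤ δ) (hc₁ : 0 < c₁) (hcA : 0 ≤ cA) (hcH : 0 ≤ cH) (hcB : 0 ≤ cB)
    (hmE : 0 < mE) (hmF : 0 < mF) (hst : ∀ x, Static3186Y x (𝔤 x) δ δ' Kw a)
    (h : ∀ (x : MemberY θ.d₆ θ.ℓ₆ θ.hd' θ.hL' θ.b₀ θ.b₁ Mstar) (α₀ : ℝ), 0 < α₀ → (geo9Y x).M * α₀ ≤ a₀ →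
      ∀ U : (bg9Y (Matrix (Fin N) (Fin N) ℂ) (specialUnitaryUnits (Fin N)) x).Cfg,
        (bg9Y (Matrix (Fin N) (Fin N) ℂ) (specialUnitaryUnits (Fin N)) x).Reg335 c35Y α₀ U →
        (bg9Y (Matrix (Fin N) (Fin N) ℂ) (specialUnitaryUnits (Fin N)) x).Reg336 c35Y α₀ U →
          givenBy3185Y x (lettersYOfRecordV4 N θ Mstar 𝔯 x) (𝔢 x) U ∧ hasRWExpCY (𝔴 x) U δ' ∧ LocalOuterY x (𝔢 x) r mE mF U ∧
            GivenBy3186Y (𝔢 x) (𝔤 x) U ∧ Local3186Y x (lettersYOfRecordV4 N θ Mstar 𝔯 x) (𝔤 x) U δ c₁ cA cH cB) :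
    B9.Thm315FullPrinted c35Y geo9Y (bg9Y (Matrix (Fin N) (Fin N) ℂ) (specialUnitaryUnits (Fin N)))
      (fun x => (opsYOfRecordV4E N θ Mstar 𝔯 𝔢 𝔴 𝔈 x).Ck) inΛY unitDistY
      (fun x => (opsYOfRecordV4E N θ Mstar 𝔯 𝔢 𝔴 𝔈 x).GivenBy3185) (fun x => (opsYOfRecordV4E N θ Mstar 𝔯 𝔢 𝔴 𝔈 x).HasRWExpC) :=
  t315_opsYSectE_of_3186 N θ Mstar (opsYS349OfRecordV4 N θ Mstar 𝔯 𝔈) (lettersYOfRecordV4 N θ Mstar 𝔯) 𝔢 𝔴 𝔤 ha₀ hδ' hδ'δ hc₁ hcA hcH hcB hmE hmF hst h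

end Record

end Literature.MathematicalPhysics.QuantumFieldTheory.Balaban1983to89.B9Thm315WholeSectE3186

end
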